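/-
O(2) `{φ, s, t}` scan: the BOX RULE SCHEMA — one structure of closed-form rules per BOX of external
dimensions giving the obligation list at every point of the box, and box exclusion from box rules.
-/
import Literature.MathematicalPhysics.QuantumFieldTheory.O2PointSchema
import Literature.MathematicalPhysics.QuantumFieldTheory.O2ApexDimBox
import HarnessLib

/-!
# O(2) `{φ, s, t}` scan: the box rule schema

`O2PointSchema.O2PointRules F A D …` packages, at ONE triple `D = (Δ_s, Δ_φ, Δ_t)` of external
dimensions, the finitely many rules from which the obligation list `O2Obligations F.toFunctional A D E₀`
follows, and `O2PointSchema.boxExcluded_of_o2PointRules` excludes a box `Q` of external dimensions from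
point rules holding AT EVERY POINT of `Q` — infinitely many points.  A certificate can only list finitely
many rule instances, so the point rules must hold UNIFORMLY on sub-boxes of `Q`.  This file packages the
uniform version:

1. **`O2DimBoxRules F A lo hi κ E₀ E_T τ a qd qr`** — the same data shape as `O2PointRules`, for the box
   `lo ≤ D ≤ hi` (`O2DimBox.InDimBox`): (N) ONE number, the unit corner number `O2DimBox.unitCorner F lo hi`;
   the light rows and the exactly placed operators as hypotheses at every `D` of the box (discharged cell
   by cell by the `…_on_dbox_cell` rules of `O2LightDimBox` / `O2ChargedLightDimBox`); rule (M) as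
   hypotheses at every `D` of the box (discharged box by box by `O2NeutralDimBox` / `O2ChargedDimBox`);
   rule (T) in CLOSED FORM by the box apex numbers of `O2ApexDimBox` (`dapexLo0p/dapexRad0p`, `dapexLoTW`,
   `dapexAbsTW`): eight sign–radius vertex matrices for `0⁺`, three numbers each for `0⁻`, `1`, `2⁺`,
   one number each for `2⁻`, `3`, `4`.
2. **`O2DimBoxRules.obligations`** — the box rules give `O2Obligations F.toFunctional A D E₀` at EVERY `D`
   of the box (through `O2PointSchema.o2Obligations_of_termwise` and the `…_of_apex_on_dbox` rules).
3. **`boxExcluded_of_o2DimBoxRules`** — functionals `F_k`, each with box rules on a box `[lo_k, hi_k]`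
   containing `Q` (the reader splits its region into such `Q` beforehand), enclosures of the external
   forms on `Q` and four certified cover trees exclude `Q`
   (`O2ScanObligations.boxExcluded_of_uniformObligations`).

NON-CLAIMS.  A soundness schema: no number is evaluated, no certificate is checked, nothing is asserted
about the O(2) model; which `E₀, E_T, τ, κ`, node configuration and boxes make the rules true for a given
functional is the verifier's business.  RECORD of the engines lane (PLANNING ONLY for the `O(2)` client
path); no published number is touched.
-/

noncomputable section

namespace Literature.MathematicalPhysics.QuantumFieldTheory.O2DimBoxSchema

open Set Finset Matrix
open Literature.MathematicalPhysics.QuantumFieldTheory.ConformalBootstrap3D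
open O2ThreeScalarCrossing O2ThreeScalarSystem OPESpaceCoverCertificate O2OPEScanBridge O2ScanObligations
open O2NeutralSectorsTermwise O2NeutralSectorsHead O2ChargedSectorsTermwise O2ChargeTwoEvenTermwise
open O2ChargeOneTermwise O2NeutralSectorsTail O2ChargedSectorsTail O2ChargedSectorsRules O2ChargeFourRules
open O2PointSchema O2DimBox O2ApexDimBox
open Literature.Analysis.ValidatedNumerics.ParametricIntervalPosSemidef (signRadMatrix)

/-! ## 1. The box rules -/

/-- **Box rules** for ONE scan functional `F` on the box `lo ≤ D ≤ hi` of external dimensions, under the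
assumptions `A`, with certificate constant `κ`, light threshold `E₀`, apex threshold `E_T`, twist margin
`τ` and node configuration (apex `a`, ratios `q^d, q^r`): the `D`-uniform analogue of
`O2PointSchema.O2PointRules`. [cite: ChesterEtAl2020, §3.1 (functional conditions), §3.3 (scanning over external dimensions)]
[cite: KosPolandSimmonsduffin2014, §3.3 eq. (3.16), §4 eqs. (4.2)–(4.3)] [cite: HogervorstRychkov2013, §3 eqs. (3.6), (3.9)] -/
structure O2DimBoxRules (F : ScanFunctional) (A : O2Gaps) (lo hi : Dims) (κ E₀ ET τ : ℝ) (a : Fin F.M)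
    (qd qr : Fin F.M → ℝ) : Prop where
  /-- `κ > 0`. -/
  κ_pos : 0 < κ
  /-- `τ ≤ 1`. -/
  τ_le_one : τ ≤ 1
  /-- `τ ≤ E₀`. -/
  τ_le : τ ≤ E₀
  /-- `1 < E₀`. -/
  one_lt : 1 < E₀
  /-- node ordering `z̄_m ≤ z_m`. -/
  ord : ∀ m, F.zb m ≤ F.z m
  /-- `q^d_m ∈ (0, 1]`. -/
  qd_mem : ∀ m, 0 < qd m ∧ qd m ≤ 1
  /-- `q^r_m ∈ (0, 1]`. -/
  qr_mem : ∀ m, 0 < qr m ∧ qr m ≤ 1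
  /-- direct-channel domination by the apex. -/
  domd : ∀ m, F.z m * F.zb m ≤ qd m ^ 2 * (F.z a * F.zb a) ∧ F.z m ≤ qd m * F.z a
  /-- crossed-channel domination by the apex. -/
  domr : ∀ m, (1 - F.z m) * (1 - F.zb m) ≤ qr m ^ 2 * (F.z a * F.zb a) ∧ 1 - F.zb m ≤ qr m * F.z a
  /-- (N) the unit corner number of the box. -/
  unit : 0 < unitCorner F lo hi
  /-- (0⁺, scalars) at every `D` of the box. -/
  scalar_0p : ∀ D, InDimBox lo hi D → ∀ Δ : ℝ, 1 / 2 ≤ Δ → A.Δ0 ≤ Δ → Δ < E₀ → Pos0p F.toFunctional D Δ 0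
  /-- (0⁺, T) at every `D` of the box. -/
  stress_0p : ∀ D, InDimBox lo hi D → Pos0p F.toFunctional D 3 2
  /-- (0⁺, spinning) at every `D` of the box. -/
  spinning_0p : ∀ D, InDimBox lo hi D → ∀ ℓ : ℕ, Even ℓ → ℓ ≠ 0 → ∀ Δ : ℝ, (ℓ : ℝ) + 1 ≤ Δ →
    (ℓ : ℝ) + 1 + A.δτ ≤ Δ → Δ < E₀ → Pos0p F.toFunctional D Δ ℓ
  /-- (0⁻, J) at every `D` of the box. -/
  current_0m : ∀ D, InDimBox lo hi D → Pos0m F.toFunctional D 2 1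
  /-- (0⁻, spinning) at every `D` of the box. -/
  spinning_0m : ∀ D, InDimBox lo hi D → ∀ ℓ : ℕ, Odd ℓ → ∀ Δ : ℝ, (ℓ : ℝ) + 1 ≤ Δ →
    (ℓ : ℝ) + 1 + A.δτ ≤ Δ → Δ < E₀ → Pos0m F.toFunctional D Δ ℓ
  /-- (1, scalars) at every `D` of the box. -/
  scalar_1 : ∀ D, InDimBox lo hi D → ∀ Δ : ℝ, 1 / 2 ≤ Δ → A.Δ1 ≤ Δ → Δ < E₀ → Pos1 F.toFunctional D Δ 0
  /-- (1, spinning) at every `D` of the box. -/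
  spinning_1 : ∀ D, InDimBox lo hi D → ∀ ℓ : ℕ, ℓ ≠ 0 → ∀ Δ : ℝ, (ℓ : ℝ) + 1 ≤ Δ →
    (ℓ : ℝ) + 1 + A.δτ ≤ Δ → Δ < E₀ → Pos1 F.toFunctional D Δ ℓ
  /-- (2⁺, scalars) at every `D` of the box. -/
  scalar_2p : ∀ D, InDimBox lo hi D → ∀ Δ : ℝ, 1 / 2 ≤ Δ → A.Δ2 ≤ Δ → Δ < E₀ → Pos2p F.toFunctional D Δ 0
  /-- (2⁺, spinning) at every `D` of the box. -/
  spinning_2p : ∀ D, InDimBox lo hi D → ∀ ℓ : ℕ, Even ℓ → ℓ ≠ 0 → ∀ Δ : ℝ, (ℓ : ℝ) + 1 ≤ Δ →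
    (ℓ : ℝ) + 1 + A.δτ ≤ Δ → Δ < E₀ → Pos2p F.toFunctional D Δ ℓ
  /-- (2⁻, spinning) at every `D` of the box. -/
  spinning_2m : ∀ D, InDimBox lo hi D → ∀ ℓ : ℕ, Odd ℓ → ∀ Δ : ℝ, (ℓ : ℝ) + 1 ≤ Δ →
    (ℓ : ℝ) + 1 + A.δτ ≤ Δ → Δ < E₀ → Pos2m F.toFunctional D Δ ℓ
  /-- (3, scalars) at every `D` of the box. -/
  scalar_3 : ∀ D, InDimBox lo hi D → ∀ Δ : ℝ, 1 / 2 ≤ Δ → A.Δ3 ≤ Δ → Δ < E₀ → Pos3 F.toFunctional D Δ 0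
  /-- (3, spinning) at every `D` of the box. -/
  spinning_3 : ∀ D, InDimBox lo hi D → ∀ ℓ : ℕ, ℓ ≠ 0 → ∀ Δ : ℝ, (ℓ : ℝ) + 1 ≤ Δ →
    (ℓ : ℝ) + 1 + A.δτ ≤ Δ → Δ < E₀ → Pos3 F.toFunctional D Δ ℓ
  /-- (4, scalars) at every `D` of the box. -/
  scalar_4 : ∀ D, InDimBox lo hi D → ∀ Δ : ℝ, 1 / 2 ≤ Δ → A.Δ4 ≤ Δ → Δ < E₀ → Pos4 F.toFunctional D Δ 0
  /-- (4, spinning) at every `D` of the box. -/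
  spinning_4 : ∀ D, InDimBox lo hi D → ∀ ℓ : ℕ, Even ℓ → ℓ ≠ 0 → ∀ Δ : ℝ, (ℓ : ℝ) + 1 ≤ Δ →
    (ℓ : ℝ) + 1 + A.δτ ≤ Δ → Δ < E₀ → Pos4 F.toFunctional D Δ ℓ
  /-- (M, 0⁺) at every `D` of the box. -/
  mid_0p : ∀ D, InDimBox lo hi D → ∀ (j : ℕ) (E : ℝ), E₀ ≤ E → E < ET → (j : ℝ) + τ ≤ E →
    (termMatrix0p F D E j).PosSemidef
  /-- (M, 0⁻) at every `D` of the box. -/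
  mid_0m : ∀ D, InDimBox lo hi D → ∀ (j : ℕ) (E : ℝ), E₀ ≤ E → E < ET → (j : ℝ) + τ ≤ E →
    (termMatrix0m F D E j).PosSemidef
  /-- (M, 1) at every `D` of the box. -/
  mid_1 : ∀ D, InDimBox lo hi D → ∀ (j : ℕ) (E : ℝ), E₀ ≤ E → E < ET → (j : ℝ) + τ ≤ E →
    kernelTest1 F D κ E j
  /-- (M, 2⁺) at every `D` of the box. -/
  mid_2p : ∀ D, InDimBox lo hi D → ∀ (j : ℕ) (E : ℝ), E₀ ≤ E → E < ET → (j : ℝ) + τ ≤ E →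
    kernelTest2p F D E j
  /-- (M, 2⁻) at every `D` of the box. -/
  mid_2m : ∀ D, InDimBox lo hi D → ∀ (j : ℕ) (E : ℝ), E₀ ≤ E → E < ET → (j : ℝ) + τ ≤ E →
    0 ≤ dom2mTerm F D E j
  /-- (M, 3) at every `D` of the box. -/
  mid_3 : ∀ D, InDimBox lo hi D → ∀ (j : ℕ) (E : ℝ), E₀ ≤ E → E < ET → (j : ℝ) + τ ≤ E →
    0 ≤ dom3Term F D E j
  /-- (M, 4) at every `D` of the box. -/
  mid_4 : ∀ D, InDimBox lo hi D → ∀ (j : ℕ) (E : ℝ), E₀ ≤ E → E < ET → (j : ℝ) + τ ≤ E →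
    0 ≤ sector4Term F D E j
  /-- (T, 0⁺): the eight sign–radius vertex matrices of the BOX apex tables are PSD. -/
  apex_0p : ∀ z : Fin 3 → Bool,
    (signRadMatrix (dapexLo0p F a qd qr lo hi ET) (dapexRad0p F a qd qr lo ET) z).PosSemidef
  /-- (T, 0⁻): `X ≥ 0` (box apex number). -/
  apexX_0m : 0 ≤ dapexLoTW F (cw0m F 0 0) (dw0m F 0 0) a qd qr (lo.expo (lab0m 0 0))
    (hi.expo (lab0m 0 0)) ET
  /-- (T, 0⁻): `Y ≥ 0`. -/
  apexY_0m : 0 ≤ dapexLoTW F (cw0m F 1 1) (dw0m F 1 1) a qd qr (lo.expo (lab0m 1 1))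
    (hi.expo (lab0m 1 1)) ET
  /-- (T, 0⁻): `Z² ≤ XY`. -/
  apexZ_0m : dapexAbsTW F (cw0m F 0 1) (dw0m F 0 1) a qd qr (lo.expo (lab0m 0 1)) ET ^ 2 ≤
    dapexLoTW F (cw0m F 0 0) (dw0m F 0 0) a qd qr (lo.expo (lab0m 0 0)) (hi.expo (lab0m 0 0)) ET *
      dapexLoTW F (cw0m F 1 1) (dw0m F 1 1) a qd qr (lo.expo (lab0m 1 1)) (hi.expo (lab0m 1 1)) ET
  /-- (T, 1): `X ≥ 0`. -/
  apexX_1 : 0 ≤ dapexLoTW F (cWeightX1 F κ) (dWeightX1 F κ) a qd qr (lo.expo .sφφs) (hi.expo .sφφs) ET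
  /-- (T, 1): `Y ≥ 0`. -/
  apexY_1 : 0 ≤ dapexLoTW F (cWeightY1 F κ) (dWeightY1 F κ) a qd qr (lo.expo .φttφ) (hi.expo .φttφ) ET
  /-- (T, 1): `Z² ≤ 4XY`. -/
  apexZ_1 : dapexAbsTW F (cwW1 F) (cwW1 F) a qd qr (expoW1 lo) ET ^ 2 ≤
    4 * dapexLoTW F (cWeightX1 F κ) (dWeightX1 F κ) a qd qr (lo.expo .sφφs) (hi.expo .sφφs) ET *
      dapexLoTW F (cWeightY1 F κ) (dWeightY1 F κ) a qd qr (lo.expo .φttφ) (hi.expo .φttφ) ET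
  /-- (T, 2⁺): `X ≥ 0`. -/
  apexX_2p : 0 ≤ dapexLoTW F (cwP F) (dwP F) a qd qr (lo.expo .φφφφ) (hi.expo .φφφφ) ET
  /-- (T, 2⁺): `Y ≥ 0`. -/
  apexY_2p : 0 ≤ dapexLoTW F (cWeight2m F) (dWeight2m F) a qd qr (lo.expo .stts) (hi.expo .stts) ET
  /-- (T, 2⁺): `Z² ≤ 4XY`. -/
  apexZ_2p : dapexAbsTW F (cwQ F) (dwQ F) a qd qr (expoQ lo) ET ^ 2 ≤
    4 * dapexLoTW F (cwP F) (dwP F) a qd qr (lo.expo .φφφφ) (hi.expo .φφφφ) ET *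
      dapexLoTW F (cWeight2m F) (dWeight2m F) a qd qr (lo.expo .stts) (hi.expo .stts) ET
  /-- (T, 2⁻): one box apex inequality. -/
  apex_2m : 0 ≤ dapexLoTW F (cWeight2m F) (dWeight2m F) a qd qr (lo.expo .stts) (hi.expo .stts) ET
  /-- (T, 3): one box apex inequality. -/
  apex_3 : 0 ≤ dapexLoTW F (cWeight3 F) (dWeight3 F) a qd qr (lo.expo .φttφ) (hi.expo .φttφ) ET
  /-- (T, 4): one box apex inequality. -/
  apex_4 : 0 ≤ dapexLoTW F (cWeight4 F) (dWeight4 F) a qd qr (lo.expo .tttt) (hi.expo .tttt) ET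

namespace O2DimBoxRules

variable {F : ScanFunctional} {A : O2Gaps} {lo hi : Dims} {κ E₀ ET τ : ℝ} {a : Fin F.M}
  {qd qr : Fin F.M → ℝ}

/-- **The box schema**: box rules give the obligation list at EVERY `D` of the box, every tail in closed
form by the box apex numbers. [cite: ChesterEtAl2020, §3.1 (functional conditions), §3.3 (scanning over external dimensions)]
[cite: KosPolandSimmonsduffin2014, §3.3 eq. (3.16), §4 eqs. (4.2)–(4.3)] [cite: HogervorstRychkov2013, §3 eqs. (3.6), (3.9)] -/
theorem obligations (h : O2DimBoxRules F A lo hi κ E₀ ET τ a qd qr) :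
    ∀ D, InDimBox lo hi D → O2Obligations F.toFunctional A D E₀ := fun D hD =>
  o2Obligations_of_termwise F A D h.κ_pos h.τ_le_one h.τ_le h.one_lt
    (h.unit.trans_le (unitCorner_le_unitNumber F hD))
    (h.scalar_0p D hD) (h.stress_0p D hD) (h.spinning_0p D hD) (h.current_0m D hD) (h.spinning_0m D hD)
    (h.scalar_1 D hD) (h.spinning_1 D hD) (h.scalar_2p D hD) (h.spinning_2p D hD) (h.spinning_2m D hD)
    (h.scalar_3 D hD) (h.spinning_3 D hD) (h.scalar_4 D hD) (h.spinning_4 D hD)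
    (h.mid_0p D hD) (h.mid_0m D hD) (h.mid_1 D hD) (h.mid_2p D hD) (h.mid_2m D hD) (h.mid_3 D hD)
    (h.mid_4 D hD)
    (termMatrix0p_posSemidef_of_apex_on_dbox F h.ord a qd qr h.qd_mem h.qr_mem h.domd h.domr h.apex_0p
      D hD)
    (termMatrix0m_posSemidef_of_apex_on_dbox F h.ord a qd qr h.qd_mem h.qr_mem h.domd h.domr
      h.apexX_0m h.apexY_0m h.apexZ_0m D hD)
    (kernelTest1_of_apex_on_dbox F h.ord a qd qr h.qd_mem h.qr_mem h.domd h.domr κ h.apexX_1 h.apexY_1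
      h.apexZ_1 D hD)
    (kernelTest2p_of_apex_on_dbox F h.ord a qd qr h.qd_mem h.qr_mem h.domd h.domr h.apexX_2p
      h.apexY_2p h.apexZ_2p D hD)
    (dom2mTerm_nonneg_of_apex_on_dbox F h.ord a qd qr h.qd_mem h.qr_mem h.domd h.domr h.apex_2m D hD)
    (dom3Term_nonneg_of_apex_on_dbox F h.ord a qd qr h.qd_mem h.qr_mem h.domd h.domr h.apex_3 D hD)
    (sector4Term_nonneg_of_apex_on_dbox F h.ord a qd qr h.qd_mem h.qr_mem h.domd h.domr h.apex_4
      D hD)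

/-- The box read as the `Icc`-product `[lo.Δs, hi.Δs] × [lo.Δφ, hi.Δφ] × [lo.Δt, hi.Δt]`.
[cite: ChesterEtAl2020, §3.3 (scanning over external dimensions)] -/
theorem obligations_on_Icc (h : O2DimBoxRules F A lo hi κ E₀ ET τ a qd qr) :
    ∀ D : Dims, (D.Δs, D.Δφ, D.Δt) ∈ Icc lo.Δs hi.Δs ×ˢ (Icc lo.Δφ hi.Δφ ×ˢ Icc lo.Δt hi.Δt) →
      O2Obligations F.toFunctional A D E₀ := fun D hD =>
  h.obligations D (by simp only [Set.mem_prod, Set.mem_Icc] at hD; exact ⟨hD.1, hD.2.1, hD.2.2⟩)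

/-- The box rules give the `l`-independent half of the functional conditions at every `D` of the box.
[cite: ChesterEtAl2020, §3.1 (functional conditions)] -/
theorem isPositiveFor_zero (h : O2DimBoxRules F A lo hi κ E₀ ET τ a qd qr) :
    ∀ D, InDimBox lo hi D → IsPositiveFor F.toFunctional A D 0 := fun D hD =>
  (h.obligations D hD).isPositiveFor_zero

end O2DimBoxRules

/-! ## 2. Box exclusion from box rules -/

/-- **BOX EXCLUSION FROM BOX RULES.**  A set `Q` of external dimensions, finitely or infinitely many scan
functionals `F_k`, each with box rules on a box `[lo_k, hi_k]` CONTAINING `Q`, ONE family of enclosures of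
their external forms valid on `Q` and FOUR certified cover trees ⇒ no unitary `O(2)` solution of the
assumptions `A` has `(Δ_s, Δ_φ, Δ_t) ∈ Q`.  (A reader covering a region by many boxes applies this box by
box and takes the union, `O2ScanObligations.BoxExcluded` being monotone in `Q`.)
[cite: ChesterEtAl2020, §3.3 (allowed and disallowed points; Algorithm 1), §3.1 (functional conditions)] -/
theorem boxExcluded_of_o2DimBoxRules {A : O2Gaps} {Q : Set (ℝ × ℝ × ℝ)} {ι : Type*}
    (F : ι → ScanFunctional) (lo hi : ι → Dims) (κ E₀ ET τ : ι → ℝ) (a : ∀ k, Fin (F k).M)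
    (qd qr : ∀ k, Fin (F k).M → ℝ) (Blo Bhi : ι → Matrix (Fin 4) (Fin 4) ℝ)
    (T : Fin 4 → CoverTree ι 4)
    (hQ : ∀ D : Dims, (D.Δs, D.Δφ, D.Δt) ∈ Q → ∀ k, InDimBox (lo k) (hi k) D)
    (hR : ∀ k, O2DimBoxRules (F k) A (lo k) (hi k) (κ k) (E₀ k) (ET k) (τ k) (a k) (qd k) (qr k))
    (henc : ∀ D : Dims, (D.Δs, D.Δφ, D.Δt) ∈ Q → ∀ k, ExtEnclosed (F k).toFunctional D (Blo k) (Bhi k))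
    (hT : ∀ i : Fin 4, (T i).Certifies (intervalVertexTest Blo Bhi) (facetLo i) (fun _ => (1 : ℝ))) :
    BoxExcluded A Q :=
  boxExcluded_of_uniformObligations F E₀ Blo Bhi T (fun D hD k => (hR k).obligations D (hQ D hD k))
    henc hT

/-- The same under STRONGER assumptions `A'` (`A.Weaker A'`).
[cite: ChesterEtAl2020, §2.2 (assumptions about the spectrum), §4.1 (gap assumptions)] -/
theorem boxExcluded_of_o2DimBoxRules_of_weaker {A A' : O2Gaps} {Q : Set (ℝ × ℝ × ℝ)} {ι : Type*}
    (hw : A.Weaker A') (F : ι → ScanFunctional) (lo hi : ι → Dims) (κ E₀ ET τ : ι → ℝ)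
    (a : ∀ k, Fin (F k).M) (qd qr : ∀ k, Fin (F k).M → ℝ) (Blo Bhi : ι → Matrix (Fin 4) (Fin 4) ℝ)
    (T : Fin 4 → CoverTree ι 4)
    (hQ : ∀ D : Dims, (D.Δs, D.Δφ, D.Δt) ∈ Q → ∀ k, InDimBox (lo k) (hi k) D)
    (hR : ∀ k, O2DimBoxRules (F k) A (lo k) (hi k) (κ k) (E₀ k) (ET k) (τ k) (a k) (qd k) (qr k))
    (henc : ∀ D : Dims, (D.Δs, D.Δφ, D.Δt) ∈ Q → ∀ k, ExtEnclosed (F k).toFunctional D (Blo k) (Bhi k))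
    (hT : ∀ i : Fin 4, (T i).Certifies (intervalVertexTest Blo Bhi) (facetLo i) (fun _ => (1 : ℝ))) :
    BoxExcluded A' Q :=
  (boxExcluded_of_o2DimBoxRules F lo hi κ E₀ ET τ a qd qr Blo Bhi T hQ hR henc hT).of_weaker hw

end Literature.MathematicalPhysics.QuantumFieldTheory.O2DimBoxSchema

end
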